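import Summits.HubbardSuperconductivity.HubbardSuperconductivity.Theorems.CooperPairDMottWalkCooperPairDMottPairTrialCeilingDecomposition
import Summits.HubbardSuperconductivity.HubbardSuperconductivity.Theorems.CooperPairDMottWalkCooperPairDMottPairTrialCeilingPlaquetteData
import Literature.MathematicalPhysics.QuantumLattice.BdGBondHamiltonianTorus

/-!
# Route `CooperPairDMottWalk`, crux `CooperPairDMott` (stmt-HubbardSuperconductivity-1177):
# stub D′b `stub_dWaveResidueStructural` — the plaquette decomposition of the `d`-wave pair field

Support file for the registered line `Cruxes/CooperPairDMott/Lines/birth.lean` (stub D′b: a macroscopic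
`d_{x²−y²}` amplitude `⟨φ₂, Δ_d φ₀⟩`, `Δ_d = pairField dWaveFormFactor L`, between the parent and the two-hole
ground states of the breathing torus). The reduction of D′b (file `…DWaveResidueStructural`) splits
`Δ_d^{(L)} = (m/2) Σ_c A_c + (remainder)`, `A_c = (f_c)_*|π⟩⟨σ|` the pair-removal operators of the `(L/2)²`
plaquettes, and leaves the smallness of the remainder's matrix element (S3) to a locality engine. This file
proves the EXACT OPERATOR IDENTITIES behind that split, for even `L` and the block embeddings
`f_c : X ↦ 2c + X`:

* `pairField_dWave_eq_sum_jwEmbed_add_inter`: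
  `Δ_d^{(L)} = ½ Σ_c (f_c)_* Δ_d^{(2)} + √2 (Σ_{x₀ odd} B_x(e₁) − Σ_{x₁ odd} B_x(e₂))`, `B_x(eᵢ) = torusBondPair L x i`
  the singlet pair on the directed bond `(x, x + eᵢ)`: the intra-plaquette bonds of `Δ_d^{(L)}` (written in
  directed-bond form, `pairField_dWaveFormFactor_eq`) are the embedded bonds of the side-`2` torus
  `Δ_d^{(2)} = pairField dWaveFormFactor 2` — in which every plaquette bond is counted TWICE
  (`sum_torusBondPair_two`, whence the `½`) — each once (`sum_blocks_torusBondPair`, the bijection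
  `(c, X) ↦ f_c X` between `[0,L/2)² × {Xᵢ = 0}` and the sites with even `i`-th coordinate;
  `jwEmbed_torusBondPair_two`, `f_c(X + eᵢ) = f_c X + eᵢ`); the bonds `(x, x+eᵢ)` with `xᵢ` odd join two
  plaquettes;
* `pairField_dWave_sub_smul_sum_eq`: hence `Δ_d^{(L)} − (m/2) Σ_c A_c = ½ Σ_c (f_c)_*(Δ_d^{(2)} − m|π⟩⟨σ|) + inter`,
  and for `m = ⟨π, Δ_d^{(2)} σ⟩` the one-plaquette operator `Δ_d^{(2)} − m|π⟩⟨σ|` has NO `π`–`σ` matrix element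
  (`star_dotProduct_remainder_mulVec_eq_zero`): the remainder of S3 consists of excited intra-plaquette
  channels and inter-plaquette bonds only, both with vanishing matrix element between the `b = 0` states.

References: D. J. Scalapino, Phys. Rep. 250 (1995) 329, §2 eqs. (2.2)–(2.3) [Scalapino1995]; D. Ruelle,
*Statistical Mechanics* (1969) §2.2 (block decompositions). All statements are [folklore]; no definition is
introduced.
-/

set_option linter.dupNamespace false

noncomputable section

namespace Summit.HubbardSuperconductivity.HubbardSuperconductivity.Theorems.CooperPairDMottWalk

open Matrix Finset Literature.MathematicalPhysics.QuantumLattice Literature.Probability.LatticeModels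
open scoped ComplexOrder

/-! ### The plaquette torus: every bond is counted twice -/

/-- On the torus of side `2`, shifting the base point of a directed bond by the bond vector gives the
same singlet pair operator (`x + 2eᵢ = x` and the singlet is symmetric). [folklore] -/
theorem torusBondPair_two_add_single (X : TorusSite 2 2) (i : Fin 2) :
    torusBondPair 2 (X + Pi.single i 1) i = torusBondPair 2 X i := by
  have h2 : X + Pi.single i 1 + Pi.single i (1 : ZMod 2) = X := by
    rw [add_assoc, ← Pi.single_add]
    have : (1 : ZMod 2) + 1 = 0 := by decide
    rw [this, Pi.single_zero, add_zero]
  rw [torusBondPair_eq, torusBondPair_eq, h2, annihilation_singlet_swap]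

/-- On the torus of side `2`, `Σ_X B_X(eᵢ) = 2 Σ_{X : Xᵢ = 0} B_X(eᵢ)`. [folklore] -/
theorem sum_torusBondPair_two (i : Fin 2) :
    ∑ X : TorusSite 2 2, torusBondPair 2 X i =
      (2 : ℂ) • ∑ X ∈ Finset.univ.filter (fun X : TorusSite 2 2 => X i = 0), torusBondPair 2 X i := by
  classical
  have h01 : ∀ a : ZMod 2, a ≠ 0 → a = 1 := by decide
  have h10 : (1 : ZMod 2) + 1 = 0 := by decide
  rw [← Finset.sum_filter_add_sum_filter_not Finset.univ (fun X : TorusSite 2 2 => X i = 0), two_smul]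
  congr 1
  refine Finset.sum_nbij' (fun X => X + Pi.single i 1) (fun X => X + Pi.single i 1) ?_ ?_ ?_ ?_ ?_
  · intro X hX
    rw [Finset.mem_filter] at hX ⊢
    refine ⟨Finset.mem_univ _, ?_⟩
    rw [Pi.add_apply, Pi.single_eq_same, h01 _ hX.2, h10]
  · intro X hX
    rw [Finset.mem_filter] at hX ⊢
    refine ⟨Finset.mem_univ _, ?_⟩
    rw [Pi.add_apply, Pi.single_eq_same, hX.2, zero_add]
    exact one_ne_zero
  · intro X _
    rw [add_assoc, ← Pi.single_add, h10, Pi.single_zero, add_zero]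
  · intro X _
    rw [add_assoc, ← Pi.single_add, h10, Pi.single_zero, add_zero]
  · intro X _
    rw [torusBondPair_two_add_single]


/-! ### Block embeddings on torus coordinates -/

section Blocks

variable {L : ℕ} [NeZero L]

omit [NeZero L] in
/-- Torus coordinates of an embedded plaquette site: `(f_c X)_j = 2c_j + X_j (mod L)`. [folklore] -/
theorem toTorusSite_blockFamily_apply {f : FermionTorus 2 2 ↪o FermionTorus 2 L} {c : ℕ × ℕ}
    (hf : ∀ X j, (ofLex (f X) j : ℕ) = ![c.1 * 2, c.2 * 2] j + (ofLex X j : ℕ)) (X : TorusSite 2 2) (j : Fin 2) :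
    FermionTorus.toTorusSite (f (FermionTorus.ofTorusSite X)) j = ((![c.1 * 2, c.2 * 2] j + (X j).val : ℕ) : ZMod L) := by
  rw [FermionTorus.toTorusSite_apply, hf, FermionTorus.ofLex_ofTorusSite_apply]

/-- The value of a coordinate of `ZMod 2` is `0` or `1`. [folklore] -/
theorem zmod_two_val_le (a : ZMod 2) : a.val ≤ 1 := by
  have := ZMod.val_lt a
  omega

/-- **A block embedding carries the directed plaquette bond `(X, X + eᵢ)`, `Xᵢ = 0`, onto the directed
torus bond based at `f_c X`**: `f_c (X + eᵢ) = f_c X + eᵢ` in torus coordinates. [folklore] -/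
theorem blockFamily_ofTorusSite_add_single {f : FermionTorus 2 2 ↪o FermionTorus 2 L} {c : ℕ × ℕ}
    (hf : ∀ X j, (ofLex (f X) j : ℕ) = ![c.1 * 2, c.2 * 2] j + (ofLex X j : ℕ))
    (hc : c ∈ Finset.range (L / 2) ×ˢ Finset.range (L / 2)) (X : TorusSite 2 2) (i : Fin 2) (hXi : X i = 0) :
    f (FermionTorus.ofTorusSite (X + Pi.single i 1)) =
      FermionTorus.ofTorusSite (FermionTorus.toTorusSite (f (FermionTorus.ofTorusSite X)) + Pi.single i 1) := by
  rw [Finset.mem_product, Finset.mem_range, Finset.mem_range] at hc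
  have hoff : ∀ j : Fin 2, ![c.1 * 2, c.2 * 2] j + 2 ≤ L := by
    intro j
    fin_cases j <;> simp only [Matrix.cons_val_zero, Matrix.cons_val_one, Fin.zero_eta, Fin.mk_one] <;> omega
  refine FermionTorus.ext_coord fun j => ?_
  rw [hf, FermionTorus.ofLex_ofTorusSite_apply, FermionTorus.ofLex_ofTorusSite_apply, Pi.add_apply,
    Pi.add_apply, toTorusSite_blockFamily_apply hf]
  by_cases hij : j = i
  · subst hij
    rw [Pi.single_eq_same, Pi.single_eq_same, hXi, zero_add, ZMod.val_one, ZMod.val_zero, add_zero,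
      ← Nat.cast_succ, ZMod.val_cast_of_lt (by have := hoff j; omega)]
  · rw [Pi.single_eq_of_ne hij, Pi.single_eq_of_ne hij, add_zero, add_zero,
      ZMod.val_cast_of_lt (by have := hoff j; have := zmod_two_val_le (X j); omega)]

/-- **Second quantisation of a plaquette bond pair**: for `Xᵢ = 0`,
`(f_c)_* B^{(2)}_X(eᵢ) = B^{(L)}_{f_c X}(eᵢ)`. [folklore] -/
theorem jwEmbed_torusBondPair_two {f : FermionTorus 2 2 ↪o FermionTorus 2 L} {c : ℕ × ℕ}
    (hf : ∀ X j, (ofLex (f X) j : ℕ) = ![c.1 * 2, c.2 * 2] j + (ofLex X j : ℕ))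
    (hc : c ∈ Finset.range (L / 2) ×ˢ Finset.range (L / 2)) (X : TorusSite 2 2) (i : Fin 2) (hXi : X i = 0) :
    jwEmbed (orbEmb f) (torusBondPair 2 X i) =
      torusBondPair L (FermionTorus.toTorusSite (f (FermionTorus.ofTorusSite X))) i := by
  rw [torusBondPair_eq, torusBondPair_eq, jwEmbed_sub', jwEmbed_mul', jwEmbed_mul', jwEmbed_annihilation,
    jwEmbed_annihilation, jwEmbed_annihilation, jwEmbed_annihilation, orbEmb_orb, orbEmb_orb, orbEmb_orb, orbEmb_orb,
    FermionTorus.ofTorusSite_toTorusSite, ← blockFamily_ofTorusSite_add_single hf hc X i hXi]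

end Blocks


/-! ### The intra-plaquette directed bonds are the embedded plaquette bonds -/

section Tiling

variable {L : ℕ} [NeZero L]

omit [NeZero L] in
/-- The block offsets are even and leave room for a plaquette: `2c_j + 2 ≤ L`. [folklore] -/
theorem blockOffset_add_two_le {c : ℕ × ℕ} (hc : c ∈ Finset.range (L / 2) ×ˢ Finset.range (L / 2)) (j : Fin 2) :
    ![c.1 * 2, c.2 * 2] j + 2 ≤ L ∧ ![c.1 * 2, c.2 * 2] j % 2 = 0 ∧ ![c.1 * 2, c.2 * 2] j / 2 = ![c.1, c.2] j := by
  rw [Finset.mem_product, Finset.mem_range, Finset.mem_range] at hc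
  have two : ∀ j : Fin 2, j = 0 ∨ j = 1 := by decide
  rcases two j with rfl | rfl
  · simp only [Matrix.cons_val_zero]; omega
  · simp only [Matrix.cons_val_one, Matrix.cons_val_zero]; omega

omit [NeZero L] in
/-- Torus coordinates of an embedded plaquette site, as natural numbers: `2c_j + X_j`. [folklore] -/
theorem val_toTorusSite_blockFamily {f : ℕ × ℕ → (FermionTorus 2 2 ↪o FermionTorus 2 L)}
    (hf : ∀ c ∈ Finset.range (L / 2) ×ˢ Finset.range (L / 2), ∀ X j,
      (ofLex (f c X) j : ℕ) = ![c.1 * 2, c.2 * 2] j + (ofLex X j : ℕ))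
    {c : ℕ × ℕ} (hc : c ∈ Finset.range (L / 2) ×ˢ Finset.range (L / 2)) (X : TorusSite 2 2) (j : Fin 2) :
    (FermionTorus.toTorusSite (f c (FermionTorus.ofTorusSite X)) j).val = ![c.1 * 2, c.2 * 2] j + (X j).val := by
  rw [toTorusSite_blockFamily_apply (hf c hc) X j, ZMod.val_cast_of_lt]
  have h1 := (blockOffset_add_two_le hc j).1
  have h2 := zmod_two_val_le (X j)
  omega

/-- **The directed bonds `(x, x + eᵢ)` of the torus with `xᵢ` even are exactly the embedded plaquette bonds
`(f_c X, f_c X + eᵢ)`, `Xᵢ = 0`, each once** (even `L`): the corresponding bond-pair sums agree. [folklore] -/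
theorem sum_blocks_torusBondPair (hL : Even L) {f : ℕ × ℕ → (FermionTorus 2 2 ↪o FermionTorus 2 L)}
    (hf : ∀ c ∈ Finset.range (L / 2) ×ˢ Finset.range (L / 2), ∀ X j,
      (ofLex (f c X) j : ℕ) = ![c.1 * 2, c.2 * 2] j + (ofLex X j : ℕ)) (i : Fin 2) :
    ∑ c ∈ Finset.range (L / 2) ×ˢ Finset.range (L / 2),
        ∑ X ∈ Finset.univ.filter (fun X : TorusSite 2 2 => X i = 0),
          torusBondPair L (FermionTorus.toTorusSite (f c (FermionTorus.ofTorusSite X))) i =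
      ∑ x ∈ Finset.univ.filter (fun x : TorusSite 2 L => Even (x i).val), torusBondPair L x i := by
  classical
  obtain ⟨m, hm⟩ := hL
  set T := Finset.range (L / 2) ×ˢ Finset.range (L / 2) with hT
  have hval : ∀ c ∈ T, ∀ (X : TorusSite 2 2) (j : Fin 2),
      (FermionTorus.toTorusSite (f c (FermionTorus.ofTorusSite X)) j).val = ![c.1 * 2, c.2 * 2] j + (X j).val :=
    fun c hc X j => val_toTorusSite_blockFamily hf hc X j
  -- membership in `T` of the plaquette label of a torus site
  have hlabel : ∀ x : TorusSite 2 L, (((x 0).val / 2, (x 1).val / 2) : ℕ × ℕ) ∈ T := by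
    intro x
    have h0 := ZMod.val_lt (x 0)
    have h1 := ZMod.val_lt (x 1)
    rw [hT, Finset.mem_product, Finset.mem_range, Finset.mem_range]
    constructor
    · change (x 0).val / 2 < L / 2; omega
    · change (x 1).val / 2 < L / 2; omega
  rw [← Finset.sum_product (s := T) (t := Finset.univ.filter (fun X : TorusSite 2 2 => X i = 0))
    (f := fun q => torusBondPair L (FermionTorus.toTorusSite (f q.1 (FermionTorus.ofTorusSite q.2))) i)]
  refine Finset.sum_nbij' (fun q => FermionTorus.toTorusSite (f q.1 (FermionTorus.ofTorusSite q.2)))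
    (fun x => (((x 0).val / 2, (x 1).val / 2), fun k => (((x k).val % 2 : ℕ) : ZMod 2))) ?_ ?_ ?_ ?_ ?_
  · -- into the even bonds
    rintro ⟨c, X⟩ hq
    rw [Finset.mem_product, Finset.mem_filter] at hq
    obtain ⟨hc, -, hXi⟩ := hq
    change c ∈ T at hc
    change X i = 0 at hXi
    rw [Finset.mem_filter]
    refine ⟨Finset.mem_univ _, ?_⟩
    change Even (FermionTorus.toTorusSite (f c (FermionTorus.ofTorusSite X)) i).val
    rw [hval c hc X i, hXi, ZMod.val_zero, add_zero, Nat.even_iff]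
    exact (blockOffset_add_two_le hc i).2.1
  · -- back into `T × {Xᵢ = 0}`
    intro x hx
    rw [Finset.mem_filter] at hx
    obtain ⟨-, hxi⟩ := hx
    rw [Finset.mem_product, Finset.mem_filter]
    refine ⟨hlabel x, Finset.mem_univ _, ?_⟩
    change (((x i).val % 2 : ℕ) : ZMod 2) = 0
    rw [Nat.even_iff.1 hxi, Nat.cast_zero]
  · -- left inverse
    rintro ⟨c, X⟩ hq
    rw [Finset.mem_product, Finset.mem_filter] at hq
    obtain ⟨hc, -, -⟩ := hq
    change c ∈ T at hc
    have hdiv : ∀ j : Fin 2, (![c.1 * 2, c.2 * 2] j + (X j).val) / 2 = ![c.1, c.2] j ∧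
        (![c.1 * 2, c.2 * 2] j + (X j).val) % 2 = (X j).val := by
      intro j
      obtain ⟨-, h2, h3⟩ := blockOffset_add_two_le hc j
      have h4 := zmod_two_val_le (X j)
      omega
    refine Prod.ext (Prod.ext ?_ ?_) (funext fun k => ?_)
    · change (FermionTorus.toTorusSite (f c (FermionTorus.ofTorusSite X)) 0).val / 2 = c.1
      rw [hval c hc X 0, (hdiv 0).1]; rfl
    · change (FermionTorus.toTorusSite (f c (FermionTorus.ofTorusSite X)) 1).val / 2 = c.2
      rw [hval c hc X 1, (hdiv 1).1]; rfl
    · change (((FermionTorus.toTorusSite (f c (FermionTorus.ofTorusSite X)) k).val % 2 : ℕ) : ZMod 2) = X k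
      rw [hval c hc X k, (hdiv k).2, ZMod.natCast_zmod_val]
  · -- right inverse
    intro x _
    funext k
    apply ZMod.val_injective
    rw [hval _ (hlabel x)]
    change ![(x 0).val / 2 * 2, (x 1).val / 2 * 2] k + ((((x k).val % 2 : ℕ) : ZMod 2)).val = (x k).val
    rw [ZMod.val_cast_of_lt (Nat.mod_lt _ two_pos)]
    have two : ∀ j : Fin 2, j = 0 ∨ j = 1 := by decide
    rcases two k with rfl | rfl
    · simp only [Matrix.cons_val_zero]; omega
    · simp only [Matrix.cons_val_one, Matrix.cons_val_zero]; omega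
  · intro q _
    rfl

end Tiling


/-! ### The decomposition of the `d`-wave pair field -/

section PairField

variable {L : ℕ} [NeZero L]

/-- `e_*(Σ_a g a) = Σ_a e_* (g a)` (generic types, for `rw` at concrete ones). [folklore] -/
theorem jwEmbed_sum' {ι ι' α : Type*} [LinearOrder ι] [Fintype ι] [LinearOrder ι'] [Fintype ι'] (e : ι ↪o ι')
    (s : Finset α) (g : α → Matrix (Finset ι) (Finset ι) ℂ) :
    jwEmbed e (∑ a ∈ s, g a) = ∑ a ∈ s, jwEmbed e (g a) :=
  map_sum _ _ _

/-- **The embedded plaquette `d`-wave pair field** (`Δ_d^{(2)} = pairField dWaveFormFactor 2`, in which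
every bond of the plaquette appears twice): `(f_c)_* Δ_d^{(2)} = 2√2 (Σ_{X₀=0} B_{f_cX}(e₁) − Σ_{X₁=0} B_{f_cX}(e₂))`,
i.e. TWICE the restriction of `Δ_d^{(L)}` to the four bonds of the plaquette `c`. [folklore] -/
theorem jwEmbed_pairField_dWave_two {f : ℕ × ℕ → (FermionTorus 2 2 ↪o FermionTorus 2 L)}
    (hf : ∀ c ∈ Finset.range (L / 2) ×ˢ Finset.range (L / 2), ∀ X j,
      (ofLex (f c X) j : ℕ) = ![c.1 * 2, c.2 * 2] j + (ofLex X j : ℕ))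
    {c : ℕ × ℕ} (hc : c ∈ Finset.range (L / 2) ×ˢ Finset.range (L / 2)) :
    jwEmbed (orbEmb (f c)) (pairField dWaveFormFactor 2) =
      ((Real.sqrt 2 : ℝ) : ℂ) •
        ((2 : ℂ) • ∑ X ∈ Finset.univ.filter (fun X : TorusSite 2 2 => X 0 = 0),
            torusBondPair L (FermionTorus.toTorusSite (f c (FermionTorus.ofTorusSite X))) 0 -
          (2 : ℂ) • ∑ X ∈ Finset.univ.filter (fun X : TorusSite 2 2 => X 1 = 0),
            torusBondPair L (FermionTorus.toTorusSite (f c (FermionTorus.ofTorusSite X))) 1) := by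
  rw [pairField_dWaveFormFactor_eq, sum_torusBondPair_two 0, sum_torusBondPair_two 1, jwEmbed_smul', jwEmbed_sub',
    jwEmbed_smul', jwEmbed_smul', jwEmbed_sum', jwEmbed_sum',
    Finset.sum_congr rfl fun X hX => jwEmbed_torusBondPair_two (hf c hc) hc X 0 (Finset.mem_filter.1 hX).2,
    Finset.sum_congr rfl fun X hX => jwEmbed_torusBondPair_two (hf c hc) hc X 1 (Finset.mem_filter.1 hX).2]

/-- **The plaquette decomposition of the `d_{x²−y²}` pair field of the breathing torus** (even side `L`,
block embeddings `f_c : X ↦ 2c + X` of the `(L/2)²` plaquettes):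
`Δ_d^{(L)} = ½ Σ_c (f_c)_* Δ_d^{(2)} + √2 (Σ_{x₀ odd} B_x(e₁) − Σ_{x₁ odd} B_x(e₂))` — the intra-plaquette
bonds are the embedded plaquette pair fields (with the factor `½` undoing the double counting of the
side-`2` torus), the rest are the inter-plaquette bonds `(x, x + eᵢ)` with `xᵢ` odd.
[cite: Scalapino1995, §2 eq. (2.2)–(2.3)] -/
theorem pairField_dWave_eq_sum_jwEmbed_add_inter (hL : Even L) {f : ℕ × ℕ → (FermionTorus 2 2 ↪o FermionTorus 2 L)}
    (hf : ∀ c ∈ Finset.range (L / 2) ×ˢ Finset.range (L / 2), ∀ X j,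
      (ofLex (f c X) j : ℕ) = ![c.1 * 2, c.2 * 2] j + (ofLex X j : ℕ)) :
    pairField dWaveFormFactor L =
      (1 / 2 : ℂ) • ∑ c ∈ Finset.range (L / 2) ×ˢ Finset.range (L / 2),
          jwEmbed (orbEmb (f c)) (pairField dWaveFormFactor 2) +
        ((Real.sqrt 2 : ℝ) : ℂ) •
          (∑ x ∈ Finset.univ.filter (fun x : TorusSite 2 L => ¬ Even (x 0).val), torusBondPair L x 0 -
            ∑ x ∈ Finset.univ.filter (fun x : TorusSite 2 L => ¬ Even (x 1).val), torusBondPair L x 1) := by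
  classical
  rw [Finset.sum_congr rfl fun c hc => jwEmbed_pairField_dWave_two hf hc, ← Finset.smul_sum, Finset.sum_sub_distrib,
    ← Finset.smul_sum, ← Finset.smul_sum, sum_blocks_torusBondPair hL hf 0, sum_blocks_torusBondPair hL hf 1,
    pairField_dWaveFormFactor_eq,
    ← Finset.sum_filter_add_sum_filter_not Finset.univ (fun x : TorusSite 2 L => Even (x 0).val),
    ← Finset.sum_filter_add_sum_filter_not Finset.univ (fun x : TorusSite 2 L => Even (x 1).val)]
  set E0 := ∑ x ∈ Finset.univ.filter (fun x : TorusSite 2 L => Even (x 0).val), torusBondPair L x 0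
  set E1 := ∑ x ∈ Finset.univ.filter (fun x : TorusSite 2 L => Even (x 1).val), torusBondPair L x 1
  set O0 := ∑ x ∈ Finset.univ.filter (fun x : TorusSite 2 L => ¬ Even (x 0).val), torusBondPair L x 0
  set O1 := ∑ x ∈ Finset.univ.filter (fun x : TorusSite 2 L => ¬ Even (x 1).val), torusBondPair L x 1
  rw [smul_sub ((Real.sqrt 2 : ℝ) : ℂ) ((2 : ℂ) • E0), smul_smul, smul_smul, smul_sub (1 / 2 : ℂ), smul_smul, smul_smul,
    show (1 / 2 : ℂ) * (((Real.sqrt 2 : ℝ) : ℂ) * 2) = ((Real.sqrt 2 : ℝ) : ℂ) by ring, smul_sub, smul_sub, smul_add,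
    smul_add]
  abel

end PairField


/-! ### What is left of the pair field after the plaquette pair-removal operators -/

section Remainder

variable {L : ℕ} [NeZero L]

/-- **The remainder operator of S3.** With `A_c = (f_c)_*|π⟩⟨σ|` and any `m ∈ ℂ`:
`Δ_d^{(L)} − (m/2) Σ_c A_c = ½ Σ_c (f_c)_*(Δ_d^{(2)} − m|π⟩⟨σ|) + √2 (Σ_{x₀ odd} B_x(e₁) − Σ_{x₁ odd} B_x(e₂))`:
a sum of ONE-plaquette terms and the inter-plaquette bond pairs. [folklore] -/
theorem pairField_dWave_sub_smul_sum_eq (hL : Even L) {f : ℕ × ℕ → (FermionTorus 2 2 ↪o FermionTorus 2 L)}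
    (hf : ∀ c ∈ Finset.range (L / 2) ×ˢ Finset.range (L / 2), ∀ X j,
      (ofLex (f c X) j : ℕ) = ![c.1 * 2, c.2 * 2] j + (ofLex X j : ℕ))
    (π σ : Fock (Orb (FermionTorus 2 2))) (m : ℂ) :
    pairField dWaveFormFactor L -
        (m / 2) • ∑ c ∈ Finset.range (L / 2) ×ˢ Finset.range (L / 2), jwEmbed (orbEmb (f c)) (vecMulVec π (star σ)) =
      (1 / 2 : ℂ) • ∑ c ∈ Finset.range (L / 2) ×ˢ Finset.range (L / 2),
          jwEmbed (orbEmb (f c)) (pairField dWaveFormFactor 2 - m • vecMulVec π (star σ)) +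
        ((Real.sqrt 2 : ℝ) : ℂ) •
          (∑ x ∈ Finset.univ.filter (fun x : TorusSite 2 L => ¬ Even (x 0).val), torusBondPair L x 0 -
            ∑ x ∈ Finset.univ.filter (fun x : TorusSite 2 L => ¬ Even (x 1).val), torusBondPair L x 1) := by
  rw [pairField_dWave_eq_sum_jwEmbed_add_inter hL hf,
    Finset.sum_congr rfl fun c _ => (jwEmbed_sub' (orbEmb (f c)) _ _).trans
      (congrArg _ (jwEmbed_smul' (orbEmb (f c)) m _)),
    Finset.sum_sub_distrib, ← Finset.smul_sum, smul_sub (1 / 2 : ℂ), smul_smul,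
    show (1 / 2 : ℂ) * m = m / 2 by ring]
  abel

omit [NeZero L] in
/-- **The one-plaquette term of the remainder has no pair-removal amplitude**: for unit `π`, `σ` and
`m = ⟨π, Δ_d^{(2)} σ⟩`, `⟨π, (Δ_d^{(2)} − m|π⟩⟨σ|) σ⟩ = 0`. [folklore] -/
theorem star_dotProduct_remainder_mulVec_eq_zero {π σ : Fock (Orb (FermionTorus 2 2))}
    (hπ1 : star π ⬝ᵥ π = 1) (hσ1 : star σ ⬝ᵥ σ = 1) :
    star π ⬝ᵥ ((pairField dWaveFormFactor 2 - (star π ⬝ᵥ (pairField dWaveFormFactor 2 *ᵥ σ)) • vecMulVec π (star σ)) *ᵥ σ) = 0 := by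
  rw [sub_mulVec, smul_mulVec, vecMulVec_mulVec, op_smul_eq_smul, dotProduct_sub, dotProduct_smul, dotProduct_smul,
    hσ1, one_smul, hπ1, smul_eq_mul, mul_one, sub_self]

end Remainder

/-! ### Registered form -/

/-- **Registered sub-goal `dWaveResidue_pairFieldDecomposition`** (closed form, as registered on the crux
item): the plaquette decomposition of the `d`-wave pair field of the breathing torus.
[cite: Scalapino1995, §2 eq. (2.2)–(2.3)] -/
theorem dWaveResidue_pairFieldDecomposition : ∀ {L : ℕ} [NeZero L], Even L → ∀ {f : ℕ × ℕ → (FermionTorus 2 2 ↪o FermionTorus 2 L)}, (∀ c ∈ Finset.range (L / 2) ×ˢ Finset.range (L / 2), ∀ X j, (ofLex (f c X) j : ℕ) = ![c.1 * 2, c.2 * 2] j + (ofLex X j : ℕ)) → pairField dWaveFormFactor L = (1 / 2 : ℂ) • ∑ c ∈ Finset.range (L / 2) ×ˢ Finset.range (L / 2), jwEmbed (orbEmb (f c)) (pairField dWaveFormFactor 2) + ((Real.sqrt 2 : ℝ) : ℂ) • (∑ x ∈ Finset.univ.filter (fun x : TorusSite 2 L => ¬ Even (x 0).val), torusBondPair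 L x 0 - ∑ x ∈ Finset.univ.filter (fun x : TorusSite 2 L => ¬ Even (x 1).val), torusBondPair L x 1) :=
  fun hL _ hf => pairField_dWave_eq_sum_jwEmbed_add_inter hL hf

end Summit.HubbardSuperconductivity.HubbardSuperconductivity.Theorems.CooperPairDMottWalk

end
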